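import Summits.RiemannHypothesis.RiemannHypothesis.Theorems.WeilFormatCEntryPole
import Summits.RiemannHypothesis.RiemannHypothesis.Theorems.WeilFormatCEntryArch
import Summits.RiemannHypothesis.RiemannHypothesis.Theorems.WeilGroundStateGroundStateSimpleEvenKillingIntegral
import Literature.NumberTheory.LFunctions.WeilWindowForm
import Literature.Analysis.SpecialFunctions.DigammaReflection
import Summits.RiemannHypothesis.RiemannHypothesis.Theorems.MotivicDoorSemilocalMarkov
import HarnessLib

/-!
# Format C, entry theorem (L-C1) — VII: the window form of a trigonometric window (Yoshida 1992, (5.15)/(5.16))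

Helper file of the rh-explicit Weil-positivity programme (`--supports stmt-RiemannHypothesis-0098`; seat
rh-explicit-weil-2), RH-free, no definitions, no named facts.  Assembles the six sibling files
`WeilFormatCEntry{Basis,Pole,Increment,ArchIntegrals,ArchSeries,Arch}.lean`.

THE ENTRY THEOREM `weilWindowForm_sum_smul_chi_eq_explicit` (weil-3's `WeilFormatCWindowGram.weilWindowForm_sum_smul_chi`
is the abstract Gram expansion through `weilWindowSesq`; this file gives the entries IN CLOSED FORM).  For `a > 0`, a finite set of modes `s ⊂ ℤ` and coefficients
`c : ℤ → ℂ`, the window form of weil-3's dictionary (`Literature/…/WeilWindowForm.lean`,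
`weilWindowForm a u = P(u) + 𝓔_a(u) − M_a‖u‖²`, equal to `Re Q(u)` on `C(a)`) of the trigonometric window
`u = Σ_{n∈s} c_n χ_n` (`χ_n(x) = (2a)^{-1/2}e^{πinx/a}·1_{[-a,a]}`, `Yoshida1992.chi`) is the Hermitian form

  `weilWindowForm a u = Σ_n Σ_m Re(conj c_n · c_m) · G(n,m)`,  `G = POL + PRI + ARCH` REAL symmetric,

with, writing `ω_n = πn/a`, `l_k = 2k + ½`, `e_k = e^{−2a l_k}`,
* `POL(n,m) = (−1)^{n+m}(4/a)(e^{a/2} − e^{−a/2})²(1 − 4ω_nω_m)/((1 + 4ω_n²)(1 + 4ω_m²))`;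
* `PRI(n,m) = Σ_{log k<2a} Λ(k)k^{-1/2}·(K_{log k}(n,m) − 2δ_{nm})`, `K_ℓ(n,n) = 2 − 2(1 − ℓ/2a)cos ω_nℓ`,
  `K_ℓ(n,m) = −(−1)^{n+m}(sin ω_mℓ − sin ω_nℓ)/(π(n−m))`;
* `ARCH(n,n) = Re ψ(¼ + iω_n/2) − log π + Re ψ′(¼ + iω_n/2)/(4a) − (1/a)Σ_k e_k(l_k² − ω_n²)/(l_k² + ω_n²)²`;
* `ARCH(n,m) = −(−1)^{n+m}/(π(n−m))·[(½Im ψ(¼ + iω_m/2) − Σ_k e_kω_m/(l_k² + ω_m²))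
                                   − (½Im ψ(¼ + iω_n/2) − Σ_k e_kω_n/(l_k² + ω_n²))]`  (`n ≠ m`)

— symbol for symbol Yoshida's (5.15)/(5.16) for `k = ℚ` (`r₁ = 1`, `r₂ = 0`; the off-diagonal exponential sum in
the equivalent form `Σ_k e_k(l_k² − ω_nω_m)/((l_k²+ω_n²)(l_k²+ω_m²)) = (ω_nS₀(n) − ω_mS₀(m))/(ω_n − ω_m)`,
`S₀(n) = Σ_k e_k/(l_k² + ω_n²)`), derived here from the tree's own definitions (Bombieri's Markov decomposition)
rather than from the contour shift of (5.9).  The killing constant enters through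
`M_a = 2Σ_{log k<2a}Λ(k)k^{-1/2} + π/2 + log 2 + log 4π + γ` (`weilMarkovConstant_eq`, killing integral
`π/4 + (log 2)/2` of `GroundStateSimpleEven.kill_integral_weilKillingDensity_eq`) and Gauss's
`ψ(¼) = −γ − π/2 − 3 log 2`, which collapse to the printed `−log π`.

This is the matrix the format-C certificates (weil-10 FORMATC-DESIGN §1; (P) `PsdDyadic.checkPsdMid`, (E) interval
evaluation of `G`) enclose; with weil-3's dictionary `weilPositivityOn_of_weilWindowForm_sum_chi_nonneg` its
positive semidefiniteness on every `modes N` yields `WeilPositivityOn a`.  The `S = {∞, 2}` twin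
(`semilocalTwoWindowForm_sum_smul_chi`: cc-s2-4's `EntryTheoremTwo`, the `{∞,2}` Markov decomposition of
`MotivicDoorSemilocalMarkov` with the single prime length `log 2 ≤ 2b`) is the same computation.

References: H. Yoshida, Adv. Stud. Pure Math. 21 (1992) 281–325, §5 (5.15)/(5.16) p. 301 [Yoshida1992HermitianForms];
E. Bombieri, Rend. Mat. Acc. Lincei (9) 11 (2000), Thm 2 [Bombieri2000Weil].
-/

set_option linter.dupNamespace false

noncomputable section

open Complex Set MeasureTheory Finset
open scoped Real ComplexConjugate BigOperators ArithmeticFunction.vonMangoldt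

namespace Summit.RiemannHypothesis.RiemannHypothesis.Theorems.WeilFormatC

open Literature.NumberTheory.LFunctions Literature.NumberTheory.LFunctions.Yoshida1992
  Literature.Analysis.SpecialFunctions

/-! ## Constants -/

/-- `Re ψ(¼) = −γ − π/2 − 3 log 2` (Gauss). -/
theorem reDigammaQuarter_zero_eq :
    reDigammaQuarter 0 = -Real.eulerMascheroniConstant - π / 2 - 3 * Real.log 2 := by
  rw [reDigammaQuarter_zero, Literature.Analysis.SpecialFunctions.Complex.digamma_one_quarter_eq_neg_ofReal,
    Complex.neg_re, Complex.ofReal_re]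
  ring

/-- `log(4π) = 2 log 2 + log π`. -/
theorem log_four_mul_pi : Real.log (4 * π) = 2 * Real.log 2 + Real.log π := by
  rw [Real.log_mul (by norm_num) Real.pi_ne_zero, show (4 : ℝ) = 2 ^ 2 by norm_num, Real.log_pow]
  push_cast
  ring

/-- **The killing constant of the window**: `M_a = 2Σ_{log k<2a}Λ(k)k^{-1/2} + π/2 + log 2 + log 4π + γ`. -/
theorem weilMarkovConstant_eq (a : ℝ) :
    weilMarkovConstant a = 2 * (∑ n ∈ weilPrimeIndex a, (Λ n : ℝ) / Real.sqrt n) +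
      (π / 2 + Real.log 2) + (Real.log (4 * π) + Real.eulerMascheroniConstant) := by
  rw [weilMarkovConstant, GroundStateSimpleEven.kill_integral_weilKillingDensity_eq]
  ring

/-! ## The entry theorem -/

/-- **L-C1 — the window form of a trigonometric window is the Hermitian form of Yoshida's matrix (5.15)/(5.16).**
For `a > 0`, a finite set of modes `s` and coefficients `c`,
`weilWindowForm a (Σ_{n∈s} c_n χ_n) = Σ_n Σ_m Re(conj c_n · c_m)·(POL + PRI + ARCH)(n,m)` with (`ω_n = πn/a`,
`l_k = 2k + ½`, `e_k = e^{−2a l_k}`)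
* `POL(n,m) = (−1)^{n+m}(4/a)(e^{a/2} − e^{−a/2})²(1 − 4ω_nω_m)/((1 + 4ω_n²)(1 + 4ω_m²))` (Yoshida (5.1));
* `PRI(n,m) = Σ_{log k<2a} Λ(k)k^{-1/2}(K_{log k}(n,m) − 2δ_{nm})`, `K_ℓ(n,n) − 2 = −2(1 − ℓ/2a)cos ω_nℓ`,
  `K_ℓ(n,m) = −(−1)^{n+m}(sin ω_mℓ − sin ω_nℓ)/(π(n−m))`;
* `ARCH(n,n) = Re ψ(¼ + iω_n/2) − log π + Re ψ′(¼ + iω_n/2)/(4a) − (1/a)Σ_k e_k(l_k² − ω_n²)/(l_k² + ω_n²)²`,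
  `ARCH(n,m) = −(−1)^{n+m}/(π(n−m))·[(½Im ψ(¼+iω_m/2) − Σ_k e_k ω_m/(l_k²+ω_m²)) − (½Im ψ(¼+iω_n/2) − Σ_k e_k ω_n/(l_k²+ω_n²))]`.
This is the matrix the format-C certificates enclose (weil-10 FORMATC-DESIGN §1 (c1)); with weil-3's dictionary
`weilPositivityOn_of_weilWindowForm_sum_chi_nonneg` its positive semidefiniteness on every `modes N` gives
`WeilPositivityOn a`. -/
theorem weilWindowForm_sum_smul_chi_eq_explicit {a : ℝ} (ha : 0 < a) (s : Finset ℤ) (c : ℤ → ℂ) :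
    weilWindowForm a (∑ n ∈ s, c n • chi a n) =
      ∑ n ∈ s, ∑ m ∈ s, (conj (c n) * c m).re *
        (((-1 : ℝ) ^ (n + m) * (4 / a) * (Real.exp (a / 2) - Real.exp (-(a / 2))) ^ 2 *
            (1 - 4 * (π * n / a) * (π * m / a)) / ((1 + 4 * (π * n / a) ^ 2) * (1 + 4 * (π * m / a) ^ 2))) +
          (∑ k ∈ weilPrimeIndex a, (Λ k : ℝ) / Real.sqrt k *
            ((if n = m then 2 - 2 * (1 - Real.log k / (2 * a)) * Real.cos (π * n / a * Real.log k)
              else -(-1 : ℝ) ^ (n + m) * (Real.sin (π * m / a * Real.log k) - Real.sin (π * n / a * Real.log k)) /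
                (π * (n - m))) - (if n = m then 2 else 0))) +
          (if n = m then
              reDigammaQuarter (π * n / a) - Real.log π +
                (deriv Complex.digamma (1 / 4 + ((π * n / a : ℝ) : ℂ) / 2 * I)).re / (4 * a) -
                (∑' k : ℕ, Real.exp (-(2 * a * digammaNode k)) *
                  ((digammaNode k ^ 2 - (π * n / a) ^ 2) / (digammaNode k ^ 2 + (π * n / a) ^ 2) ^ 2)) / a
            else -(-1 : ℝ) ^ (n + m) / (π * (n - m)) *
              (((Complex.digamma (1 / 4 + ((π * m / a : ℝ) : ℂ) / 2 * I)).im / 2 -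
                  ∑' k : ℕ, Real.exp (-(2 * a * digammaNode k)) * ((π * m / a) / (digammaNode k ^ 2 + (π * m / a) ^ 2))) -
                ((Complex.digamma (1 / 4 + ((π * n / a : ℝ) : ℂ) / 2 * I)).im / 2 -
                  ∑' k : ℕ, Real.exp (-(2 * a * digammaNode k)) * ((π * n / a) / (digammaNode k ^ 2 + (π * n / a) ^ 2)))))) := by
  rw [weilWindowForm, weilDirichletEnergy, weilMarkovConstant_eq, weilPoleForm_sum_smul_chi ha,
    sum_weilIncrement_sum_smul_chi ha, setIntegral_weilArchDensity_mul_weilIncrement_sum_smul_chi ha,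
    integral_norm_sq_sum_smul_chi' ha]
  rw [Finset.mul_sum, ← Finset.sum_add_distrib, ← Finset.sum_add_distrib, ← Finset.sum_sub_distrib]
  refine Finset.sum_congr rfl fun n _ ↦ ?_
  rw [Finset.mul_sum, ← Finset.sum_add_distrib, ← Finset.sum_add_distrib, ← Finset.sum_sub_distrib]
  refine Finset.sum_congr rfl fun m _ ↦ ?_
  -- the prime block: `Σ_k w_k (K_k − 2δ) = Σ_k w_k K_k − 2δ Σ_k w_k`
  have hprime : ∀ (K : ℕ → ℝ) (d : ℝ), (∑ k ∈ weilPrimeIndex a, (Λ k : ℝ) / Real.sqrt k * (K k - d)) =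
      (∑ k ∈ weilPrimeIndex a, (Λ k : ℝ) / Real.sqrt k * K k) - d * ∑ k ∈ weilPrimeIndex a, (Λ k : ℝ) / Real.sqrt k := by
    intro K d
    rw [Finset.mul_sum, ← Finset.sum_sub_distrib]
    refine Finset.sum_congr rfl fun k _ ↦ ?_
    ring
  have h0 := reDigammaQuarter_zero_eq
  have h4 := log_four_mul_pi
  by_cases h : n = m
  · subst h
    simp only [if_true]
    rw [hprime, setIntegral_weilArchDensity_mul_diag ha n, h0, h4]
    ring
  · simp only [if_neg h]
    rw [hprime, setIntegral_weilArchDensity_mul_sin ha m, setIntegral_weilArchDensity_mul_sin ha n]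
    ring

/-! ## The `{∞, 2}` window form of a trigonometric window (cc-s2 format-C instance, `EntryTheoremTwo`) -/

/-- `C₂ = 2(log 2/√2) + (π/2 + log 2) + (log 4π + γ)`. -/
theorem semilocalTwoConstant_eq_sum :
    MotivicDoor.SemilocalMarkov.semilocalTwoConstant =
      2 * (Real.log 2 / Real.sqrt 2) + (π / 2 + Real.log 2) + (Real.log (4 * π) + Real.eulerMascheroniConstant) := by
  rw [MotivicDoor.SemilocalMarkov.semilocalTwoConstant, GroundStateSimpleEven.kill_integral_weilKillingDensity_eq]
  ring

/-- **L-C1 at `S = {∞, 2}`** (the window form of cc-s2-4's `EntryTheoremTwo`, i.e. the `{∞,2}` Markov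
decomposition `P(u) + (log 2/√2)·D_{log 2}(u) + ∫₀^∞ρ D_t(u) dt − C₂‖u‖²` of `MotivicDoorSemilocalMarkov`, evaluated on
a trigonometric window of half-width `b` with `log 2 ≤ 2b`, so that the single prime length `log 2` lies on the
window scale): the same Hermitian form as `weilWindowForm_sum_smul_chi_eq_explicit` with the prime block reduced to the one
length `ℓ = log 2`, weight `Λ = log 2/√2`. -/
theorem semilocalTwoWindowForm_sum_smul_chi {b : ℝ} (hb : 0 < b) (hb2 : Real.log 2 ≤ 2 * b) (s : Finset ℤ)
    (c : ℤ → ℂ) :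
    weilPoleForm (∑ n ∈ s, c n • chi b n) +
        Real.log 2 / Real.sqrt 2 * weilIncrement (∑ n ∈ s, c n • chi b n) (Real.log 2) +
        (∫ t in Ioi 0, weilArchDensity t * weilIncrement (∑ n ∈ s, c n • chi b n) t) -
        MotivicDoor.SemilocalMarkov.semilocalTwoConstant * ∫ x, ‖(∑ n ∈ s, c n • chi b n) x‖ ^ 2 =
      ∑ n ∈ s, ∑ m ∈ s, (conj (c n) * c m).re *
        (((-1 : ℝ) ^ (n + m) * (4 / b) * (Real.exp (b / 2) - Real.exp (-(b / 2))) ^ 2 *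
            (1 - 4 * (π * n / b) * (π * m / b)) / ((1 + 4 * (π * n / b) ^ 2) * (1 + 4 * (π * m / b) ^ 2))) +
          Real.log 2 / Real.sqrt 2 *
            ((if n = m then 2 - 2 * (1 - Real.log 2 / (2 * b)) * Real.cos (π * n / b * Real.log 2)
              else -(-1 : ℝ) ^ (n + m) * (Real.sin (π * m / b * Real.log 2) - Real.sin (π * n / b * Real.log 2)) /
                (π * (n - m))) - (if n = m then 2 else 0)) +
          (if n = m then
              reDigammaQuarter (π * n / b) - Real.log π +
                (deriv Complex.digamma (1 / 4 + ((π * n / b : ℝ) : ℂ) / 2 * I)).re / (4 * b) -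
                (∑' k : ℕ, Real.exp (-(2 * b * digammaNode k)) *
                  ((digammaNode k ^ 2 - (π * n / b) ^ 2) / (digammaNode k ^ 2 + (π * n / b) ^ 2) ^ 2)) / b
            else -(-1 : ℝ) ^ (n + m) / (π * (n - m)) *
              (((Complex.digamma (1 / 4 + ((π * m / b : ℝ) : ℂ) / 2 * I)).im / 2 -
                  ∑' k : ℕ, Real.exp (-(2 * b * digammaNode k)) * ((π * m / b) / (digammaNode k ^ 2 + (π * m / b) ^ 2))) -
                ((Complex.digamma (1 / 4 + ((π * n / b : ℝ) : ℂ) / 2 * I)).im / 2 -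
                  ∑' k : ℕ, Real.exp (-(2 * b * digammaNode k)) * ((π * n / b) / (digammaNode k ^ 2 + (π * n / b) ^ 2)))))) := by
  rw [semilocalTwoConstant_eq_sum, weilPoleForm_sum_smul_chi hb,
    weilIncrement_sum_smul_chi hb s c (Real.log_nonneg one_le_two) hb2,
    setIntegral_weilArchDensity_mul_weilIncrement_sum_smul_chi hb, integral_norm_sq_sum_smul_chi' hb]
  rw [Finset.mul_sum, Finset.mul_sum, ← Finset.sum_add_distrib, ← Finset.sum_add_distrib, ← Finset.sum_sub_distrib]
  refine Finset.sum_congr rfl fun n _ ↦ ?_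
  rw [Finset.mul_sum, Finset.mul_sum, ← Finset.sum_add_distrib, ← Finset.sum_add_distrib, ← Finset.sum_sub_distrib]
  refine Finset.sum_congr rfl fun m _ ↦ ?_
  have h0 := reDigammaQuarter_zero_eq
  have h4 := log_four_mul_pi
  by_cases h : n = m
  · subst h
    simp only [if_true]
    rw [setIntegral_weilArchDensity_mul_diag hb n, h0, h4]
    ring
  · simp only [if_neg h]
    rw [setIntegral_weilArchDensity_mul_sin hb m, setIntegral_weilArchDensity_mul_sin hb n]
    ring

end Summit.RiemannHypothesis.RiemannHypothesis.Theorems.WeilFormatC
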